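import Literature.Analysis.FluidPDE.NSHopfGalerkinExistence
import Literature.Analysis.FluidPDE.FracLaplacianSmooth
import HarnessLib

/-!
# Fractional Navier–Stokes on `T^d`: the fractional Galerkin ODE
  (proof of the named fact `fracGalerkin_scheme_exists`, part 1 of 2)

Analysis/FluidPDE. First module of the proof of Leray's existence theorem for the fractional
Navier–Stokes system `∂ₜv + div(v ⊗ v) + ∇p + (-Δ)^α v = 0` on the flat torus (Colombo–De
Lellis–De Rosa 2018, Thm. 1.1, proof in §9, p. 20 of the held arXiv text): the truncated problems
(NS_reg) `∂ₜw + div P_K(w ⊗ w) + ∇q + (-Δ)^α w = 0`, `w(0) = P_K v̄`, "reduce to a system of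
ordinary differential equations for the Fourier coefficients of the solution", which is globally
solvable because "`d/dt ∫|w|² = -2∫|(-Δ)^{α/2} w|²` … any solution stays bounded in `L²`".

Everything is done on the Fourier side by **reusing the tree's classical Galerkin field**
`Torus.galerkinField ν S g c` (`NSGalerkinFourier`) with viscosity `ν = 0` and the *spectral force*
`g = fracForce α c`, `g k = -(4π²|k|²)^α c k`: then
`galerkinField 0 S ḡ c̄ k = Π_k(-(4π²|k|²)^α c̄ k - 𝓕[(u·∇)u](k))` is exactly the right-hand side
of the fractional Galerkin system, the tree's master identities
(`Torus.sum_re_inner_galerkinField_test/self`) apply verbatim, and the force field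
`realTrigPoly S ḡ = -(-Δ)^α u` (`Torus.fracLaplacian_realTrigPoly`) is moved onto the test mode by
the symmetry `Torus.integral_inner_fracLaplacian_comm`.

## Contents (all proved)

* the spectral force `k ↦ -(4π²|k|²)^α c k` and the field
  `V_α(c) = galerkinRHS S 0 (k ↦ -(4π²|k|²)^α c k) c`, with their Lipschitz/continuity bounds
  (written out in full everywhere: the module introduces no definitions);
* `hasDerivWithinAt_fracEnergy` — `d/dt ∑‖β k‖² = -2 D_α(u)`, `D_α = (eFracDissipation α u).toReal`;
* `exists_fracGalerkin_solution` — global solutions of the fractional Galerkin ODE in the real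
  divergence-free coefficient vectors (`ODE.exists_solution_of_apriori_bound`, the a priori bound
  being the monotonicity of the energy);
* `fracGalerkin_test_identity`, `fracGalerkin_energy_identity` — the tested Galerkin equations
  integrated in time and the exact energy identity (the clauses `galerkin`, `energy_eq` of the
  fractional Galerkin scheme predicate `IsFracGalerkinScheme` of
  `Literature/Analysis/FluidPDE/FracNSGalerkin`; the assembly of the scheme from these pieces is
  the sequel `FracNSGalerkinSchemeExists`).

Theorem-only module (no definitions): the spectral force and the fractional Galerkin field are
written out in full in every statement.

## References

* M. Colombo, C. De Lellis, L. De Rosa, *Ill-posedness of Leray solutions for the hypodissipative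
  Navier–Stokes equations*, Comm. Math. Phys. 362 (2018), §9 (proof of Thm. 1.1).
  [`ColomboDelellisDerosa2018`]
* J. C. Robinson, J. L. Rodrigo, W. Sadowski, *The three-dimensional Navier–Stokes equations*
  (CUP 2016), Thm. 4.4 Steps 1–2 (the `α = 1` template). [`RobinsonRodrigoSadowski2016`]
-/

open MeasureTheory Set Filter Topology UnitAddTorus Metric
open scoped ENNReal NNReal InnerProductSpace

noncomputable section

namespace Literature.Analysis.FluidPDE

section FracODE

open FunctionSpaces.Torus Torus

variable {d : Type*} [Fintype d]

/-! ## The symbol on a finite frequency set -/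

section Symbol

variable {S : Finset (d → ℤ)}

omit [Fintype d] in
/-- The symbol is even: `σ_α(-k) = σ_α(k)`. [folklore] -/
theorem fracSymbol_neg [Fintype d] (α : ℝ) (k : d → ℤ) : fracSymbol α (-k) = fracSymbol α k := by
  simp [fracSymbol, freqNormSq_neg]

/-- A crude bound for the symbol on `S`: `σ_α(k) ≤ ∑_{k'∈S} σ_α(k')` for `k ∈ S`. [folklore] -/
theorem fracSymbol_le_sum (α : ℝ) {k : d → ℤ} (hk : k ∈ S) :
    fracSymbol α k ≤ ∑ k' ∈ S, fracSymbol α k' :=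
  Finset.single_le_sum (f := fracSymbol α) (fun k' _ => fracSymbol_nonneg α k') hk

end Symbol

/-! ## The spectral force `-(4π²|k|²)^α c k` and the fractional Galerkin field -/

section Field

variable [DecidableEq d] {S : Finset (d → ℤ)}

omit [DecidableEq d] in
/-- The spectral force is linear: differences. [folklore] -/
theorem fracForce_sub (α : ℝ) (c c' : ↥S → EuclideanSpace ℂ d) :
    (fun k : ↥S => -((((fracSymbol α (k : d → ℤ)) : ℝ) : ℂ) • c k)) -
        (fun k : ↥S => -((((fracSymbol α (k : d → ℤ)) : ℝ) : ℂ) • c' k)) =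
      (fun k : ↥S => -((((fracSymbol α (k : d → ℤ)) : ℝ) : ℂ) • (c - c') k)) := by
  funext k
  simp only [Pi.sub_apply, smul_sub]
  abel

omit [DecidableEq d] in
/-- **Sup-norm bound**: `‖fracForce α c‖ ≤ (∑_{k∈S} σ_α(k)) ‖c‖`. [folklore] -/
theorem norm_fracForce_le (α : ℝ) (c : ↥S → EuclideanSpace ℂ d) :
    ‖(fun k : ↥S => -((((fracSymbol α (k : d → ℤ)) : ℝ) : ℂ) • c k))‖ ≤
      (∑ k' ∈ S, fracSymbol α k') * ‖c‖ := by
  have hΛ : 0 ≤ ∑ k' ∈ S, fracSymbol α k' := Finset.sum_nonneg fun k' _ => fracSymbol_nonneg α k'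
  refine (pi_norm_le_iff_of_nonneg (by positivity)).2 fun k => ?_
  rw [norm_neg, norm_smul, Complex.norm_real, Real.norm_of_nonneg (fracSymbol_nonneg α _)]
  exact mul_le_mul (fracSymbol_le_sum α k.2) (norm_le_pi_norm c k) (norm_nonneg _) hΛ

omit [DecidableEq d] in
/-- The spectral force of a real coefficient vector is real (the symbol is real and even). [folklore] -/
theorem _root_.Literature.Analysis.FunctionSpaces.Torus.IsRealCoeff.fracForce (α : ℝ)
    {c : ↥S → EuclideanSpace ℂ d} (hc : IsRealCoeff c) :
    IsRealCoeff (fun k : ↥S => -((((fracSymbol α (k : d → ℤ)) : ℝ) : ℂ) • c k)) := by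
  intro k l h
  dsimp only
  rw [hc k l h, h, fracSymbol_neg, FunctionSpaces.EuclideanSpace.conjVec_neg,
    FunctionSpaces.EuclideanSpace.conjVec_smul, Complex.conj_ofReal]

omit [DecidableEq d] in
/-- The spectral force depends continuously (indeed linearly) on the state. [folklore] -/
theorem continuous_fracForce (α : ℝ) :
    Continuous fun (c : ↥S → EuclideanSpace ℂ d) (k : ↥S) =>
      -((((fracSymbol α (k : d → ℤ)) : ℝ) : ℂ) • c k) :=
  continuous_pi fun k =>
    (((continuous_apply k).const_smul (((fracSymbol α (k : d → ℤ)) : ℝ) : ℂ)).neg :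
      Continuous fun c : ↥S → EuclideanSpace ℂ d => -((((fracSymbol α (k : d → ℤ)) : ℝ) : ℂ) • c k))

/-! ### The fractional Galerkin vector field

The right-hand side of the fractional Galerkin system on the coefficient vectors of `S` is the
tree's classical Galerkin field at viscosity `0` driven by the spectral force,
`V_α(c) = galerkinRHS S 0 (k ↦ -(4π²|k|²)^α c k) c`, i.e.
`V_α(c)_k = Π_k(-(4π²|k|²)^α c k - 𝓕[(u·∇)u](k))` (CDLDR 2018, §9: the ODE system for the Fourier
coefficients of (NS_reg)). It is written out in full in every statement below (no abbreviation is
introduced, so that this module stays definition-free). -/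

omit [DecidableEq d] in
/-- The classical Galerkin field is `1`-Lipschitz in the force (the force enters through the
Leray symbol, a contraction, after extension by zero). [folklore] -/
theorem norm_galerkinRHS_sub_galerkinRHS_le (ν : ℝ) (g g' c : ↥S → EuclideanSpace ℂ d) :
    ‖galerkinRHS S ν g c - galerkinRHS S ν g' c‖ ≤ ‖g - g'‖ := by
  refine (pi_norm_le_iff_of_nonneg (norm_nonneg _)).2 fun k => ?_
  rw [Pi.sub_apply, galerkinRHS_apply, galerkinRHS_apply, galerkinField_def, galerkinField_def,
    add_sub_add_left_eq_sub]
  refine (norm_leraySym_sub_le _ _ _).trans ?_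
  rw [sub_sub_sub_cancel_right, ← Pi.sub_apply, ← coeffExt_sub]
  exact norm_coeffExt_le _ _

omit [DecidableEq d] in
/-- **Local Lipschitz bound** of the fractional Galerkin field on the ball `‖c‖ ≤ ρ` (sup norm):
the classical bound at viscosity `0` (`norm_galerkinRHS_sub_le`) plus the linear spectral force. [folklore] -/
theorem norm_fracGalerkinRHS_sub_le (α : ℝ) {ρ : ℝ} {c c' : ↥S → EuclideanSpace ℂ d}
    (hc : ‖c‖ ≤ ρ) (hc' : ‖c'‖ ≤ ρ) :
    ‖galerkinRHS S 0 (fun k : ↥S => -((((fracSymbol α (k : d → ℤ)) : ℝ) : ℂ) • c k)) c -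
        galerkinRHS S 0 (fun k : ↥S => -((((fracSymbol α (k : d → ℤ)) : ℝ) : ℂ) • c' k)) c'‖ ≤
      ((‖(0 : ℝ)‖ * (4 * Real.pi ^ 2 * ∑ k ∈ S, freqNormSq k) +
        2 * (2 * Real.pi * (S.card * ∑ m ∈ S, ∑ j, |(m j : ℝ)|) * ρ)) +
        ∑ k' ∈ S, fracSymbol α k') * ‖c - c'‖ := by
  set g : (↥S → EuclideanSpace ℂ d) → ↥S → EuclideanSpace ℂ d :=
    fun c k => -((((fracSymbol α (k : d → ℤ)) : ℝ) : ℂ) • c k) with hg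
  have h1 := norm_galerkinRHS_sub_le (S := S) 0 (g c) hc hc'
  have h2 := norm_galerkinRHS_sub_galerkinRHS_le (S := S) 0 (g c) (g c') c'
  have h23 : ‖galerkinRHS S 0 (g c) c' - galerkinRHS S 0 (g c') c'‖ ≤
      (∑ k' ∈ S, fracSymbol α k') * ‖c - c'‖ := by
    refine h2.trans ?_
    rw [hg, fracForce_sub]
    exact norm_fracForce_le (S := S) α (c - c')
  calc ‖galerkinRHS S 0 (g c) c - galerkinRHS S 0 (g c') c'‖
      ≤ ‖galerkinRHS S 0 (g c) c - galerkinRHS S 0 (g c) c'‖ +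
          ‖galerkinRHS S 0 (g c) c' - galerkinRHS S 0 (g c') c'‖ :=
        norm_sub_le_norm_sub_add_norm_sub _ _ _
    _ ≤ _ := by
        rw [add_mul]
        exact add_le_add h1 h23

omit [DecidableEq d] in
/-- The fractional Galerkin field is Lipschitz on every ball. [folklore] -/
theorem lipschitzOnWith_fracGalerkinRHS (α : ℝ) (ρ : ℝ) :
    LipschitzOnWith (Real.toNNReal (((‖(0 : ℝ)‖ * (4 * Real.pi ^ 2 * ∑ k ∈ S, freqNormSq k) +
        2 * (2 * Real.pi * (S.card * ∑ m ∈ S, ∑ j, |(m j : ℝ)|) * ρ)) +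
        ∑ k' ∈ S, fracSymbol α k')))
      (fun c : ↥S → EuclideanSpace ℂ d =>
        galerkinRHS S 0 (fun k : ↥S => -((((fracSymbol α (k : d → ℤ)) : ℝ) : ℂ) • c k)) c)
      (closedBall 0 ρ) := by
  refine LipschitzOnWith.of_dist_le_mul fun c hc c' hc' => ?_
  rw [dist_eq_norm, dist_eq_norm]
  rw [mem_closedBall, dist_zero_right] at hc hc'
  refine (norm_fracGalerkinRHS_sub_le α hc hc').trans (mul_le_mul_of_nonneg_right ?_ (norm_nonneg _))
  exact Real.le_coe_toNNReal _

omit [DecidableEq d] in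
/-- **Continuity** of the fractional Galerkin field. [folklore] -/
theorem continuous_fracGalerkinRHS (α : ℝ) :
    Continuous fun c : ↥S → EuclideanSpace ℂ d =>
      galerkinRHS S 0 (fun k : ↥S => -((((fracSymbol α (k : d → ℤ)) : ℝ) : ℂ) • c k)) c := by
  have h := (continuous_galerkinRHS (S := S) 0).comp
    ((continuous_fracForce (S := S) α).prodMk continuous_id)
  exact h

omit [DecidableEq d] in
/-- **Invariance**: the fractional Galerkin field maps the Galerkin phase space (real,
divergence-free coefficient vectors) into itself. [folklore] -/
theorem fracGalerkinRHS_mem (α : ℝ) (hS : ∀ k ∈ S, -k ∈ S) {c : ↥S → EuclideanSpace ℂ d}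
    (hc : c ∈ galerkinSubspace S) :
    galerkinRHS S 0 (fun k : ↥S => -((((fracSymbol α (k : d → ℤ)) : ℝ) : ℂ) • c k)) c ∈ galerkinSubspace S :=
  galerkinRHS_mem 0 hS (hc.1.fracForce α) hc

end Field

/-! ## The dissipation of a Galerkin state and the energy identity in differential form -/

section Energy

variable [DecidableEq d] {S : Finset (d → ℤ)}

omit [DecidableEq d] in
/-- **Fractional dissipation of a real trigonometric polynomial**: for `α ≠ 0`,
`∫|(-Δ)^{α/2} realTrigPoly S c|² = ofReal (∑_{k∈S} (4π²|k|²)^α ‖c k‖²)` (conjugate-symmetric `c`,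
symmetric `S`; the zero mode, omitted in `Torus.eHomSobolevSeminorm`, carries the weight
`σ_α(0) = 0`). [folklore] -/
theorem eFracDissipation_realTrigPoly {α : ℝ} (hα : α ≠ 0) (hS : ∀ k ∈ S, -k ∈ S)
    {c : (d → ℤ) → EuclideanSpace ℂ d} (hc : IsConjSymm c) :
    eFracDissipation α (realTrigPoly S c) =
      ENNReal.ofReal (∑ k ∈ S, fracSymbol α k * ‖c k‖ ^ 2) := by
  rw [eFracDissipation, eHomSobolevSeminorm, ENNReal.rpow_half_sq]
  simp_rw [mFourierCoeff_realTrigPoly hS hc]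
  rw [tsum_eq_sum (s := S) fun k hk => by simp [hk]]
  have h4 : (0 : ℝ) ≤ (4 * Real.pi ^ 2) ^ α := Real.rpow_nonneg (by positivity) α
  have hterm : ∀ k ∈ S, ENNReal.ofReal ((4 * Real.pi ^ 2) ^ α) *
      ((if k = 0 then 0 else ENNReal.ofReal (freqNormSq k ^ α)) * ‖(if k ∈ S then c k else 0)‖ₑ ^ 2) =
      ENNReal.ofReal (fracSymbol α k * ‖c k‖ ^ 2) := by
    intro k hk
    rw [if_pos hk, ← ofReal_norm, ← ENNReal.ofReal_pow (norm_nonneg _)]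
    by_cases h0 : k = 0
    · subst h0
      simp [fracSymbol_zero hα]
    · rw [if_neg h0, ← mul_assoc, ← ENNReal.ofReal_mul h4,
        ← ENNReal.ofReal_mul (mul_nonneg h4 (Real.rpow_nonneg (freqNormSq_nonneg k) α)),
        fracSymbol, Real.mul_rpow (by positivity) (freqNormSq_nonneg k)]
  rw [Finset.mul_sum, Finset.sum_congr rfl hterm, ← ENNReal.ofReal_sum_of_nonneg fun k _ =>
      mul_nonneg (fracSymbol_nonneg α k) (sq_nonneg _)]

omit [DecidableEq d] in
/-- The fractional dissipation of a Galerkin state, real form: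
`(eFracDissipation α u).toReal = ∑_k σ_α(k) ‖c k‖²` (`α ≠ 0`). [folklore] -/
theorem toReal_eFracDissipation_coeffExt {α : ℝ} (hα : α ≠ 0) (hS : ∀ k ∈ S, -k ∈ S)
    {c : ↥S → EuclideanSpace ℂ d} (hc : IsRealCoeff c) :
    (eFracDissipation α (realTrigPoly S (coeffExt S c))).toReal =
      ∑ k : ↥S, fracSymbol α (k : d → ℤ) * ‖c k‖ ^ 2 := by
  rw [eFracDissipation_realTrigPoly hα hS (hc.isConjSymm_coeffExt hS),
    sum_coeffExt (fun k v => fracSymbol α k * ‖v‖ ^ 2), ENNReal.toReal_ofReal]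
  exact Finset.sum_nonneg fun k _ => mul_nonneg (fracSymbol_nonneg α _) (sq_nonneg _)

omit [DecidableEq d] in
/-- The fractional dissipation of a Galerkin state in `ℝ≥0∞`. [folklore] -/
theorem eFracDissipation_coeffExt {α : ℝ} (hα : α ≠ 0) (hS : ∀ k ∈ S, -k ∈ S)
    {c : ↥S → EuclideanSpace ℂ d} (hc : IsRealCoeff c) :
    eFracDissipation α (realTrigPoly S (coeffExt S c)) =
      ENNReal.ofReal (∑ k : ↥S, fracSymbol α (k : d → ℤ) * ‖c k‖ ^ 2) := by
  rw [eFracDissipation_realTrigPoly hα hS (hc.isConjSymm_coeffExt hS),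
    sum_coeffExt (fun k v => fracSymbol α k * ‖v‖ ^ 2)]

omit [DecidableEq d] in
/-- **The work of the spectral force is minus the dissipation**:
`∫ ⟪realTrigPoly S (fracForce α c)‾, realTrigPoly S c̄⟫ = -∑_k σ_α(k) ‖c k‖²`. [folklore] -/
theorem integral_inner_realTrigPoly_fracForce (α : ℝ) (hS : ∀ k ∈ S, -k ∈ S)
    {c : ↥S → EuclideanSpace ℂ d} (hc : IsRealCoeff c) :
    ∫ x, ⟪realTrigPoly S (coeffExt S
        (fun k : ↥S => -((((fracSymbol α (k : d → ℤ)) : ℝ) : ℂ) • c k))) x,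
        realTrigPoly S (coeffExt S c) x⟫_ℝ =
      -∑ k : ↥S, fracSymbol α (k : d → ℤ) * ‖c k‖ ^ 2 := by
  rw [integral_inner_realTrigPoly_realTrigPoly hS ((hc.fracForce α).isConjSymm_coeffExt hS)
    (hc.isConjSymm_coeffExt hS), ← Finset.sum_coe_sort, ← Finset.sum_neg_distrib]
  refine Finset.sum_congr rfl fun k _ => ?_
  rw [coeffExt_coe, coeffExt_coe, inner_neg_left, Complex.neg_re,
    inner_smul_left, Complex.conj_ofReal, Complex.re_ofReal_mul]
  have hcc : (inner ℂ (c k) (c k)).re = ‖c k‖ ^ 2 := by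
    rw [inner_self_eq_norm_sq_to_K]; norm_cast
  rw [hcc]

/-- **The energy identity in differential form along a fractional Galerkin solution**: if
`β' = V_α(β)` within `s` at `t` with `β t` real divergence free, then
`d/dt ∑_k ‖β k‖² = -2 ∑_k σ_α(k) ‖β t k‖²` (CDLDR 2018, §9: "`d/dt ∫|w|² = -2∫|(-Δ)^{α/2}w|²`").
[cite: ColomboDelellisDerosa2018, §9 (energy identity of (NS_reg))] -/
theorem hasDerivWithinAt_fracEnergy (α : ℝ) (hS : ∀ k ∈ S, -k ∈ S)
    {β : ℝ → ↥S → EuclideanSpace ℂ d} {s : Set ℝ} {t : ℝ}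
    (h : HasDerivWithinAt β
      (galerkinRHS S 0 (fun k : ↥S => -((((fracSymbol α (k : d → ℤ)) : ℝ) : ℂ) • β t k)) (β t)) s t)
    (hβ : β t ∈ galerkinSubspace S) :
    HasDerivWithinAt (fun τ => ∑ k, ‖β τ k‖ ^ 2)
      (2 * -(∑ k : ↥S, fracSymbol α (k : d → ℤ) * ‖β t k‖ ^ 2)) s t := by
  have h1 := hasDerivWithinAt_energy (S := S) 0 hS h hβ (hβ.1.fracForce α)
  rw [zero_mul, neg_zero, zero_add, integral_inner_realTrigPoly_fracForce α hS hβ.1] at h1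
  exact h1

/-- **A priori bound (monotonicity of the energy)**: along a solution of the fractional Galerkin
ODE on `[0, s']` staying in the Galerkin phase space, `∑_k ‖β t k‖² ≤ ∑_k ‖β 0 k‖²`
(CDLDR 2018, §9: "any solution stays bounded in `L²`"; Grönwall with vanishing constants).
[cite: ColomboDelellisDerosa2018, §9 (proof of Thm. 1.1)] -/
theorem fracEnergy_apriori_bound (α : ℝ) (hS : ∀ k ∈ S, -k ∈ S) {s' : ℝ}
    {β : ℝ → ↥S → EuclideanSpace ℂ d}
    (hβ : ∀ t ∈ Icc 0 s', HasDerivWithinAt β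
      (galerkinRHS S 0 (fun k : ↥S => -((((fracSymbol α (k : d → ℤ)) : ℝ) : ℂ) • β t k)) (β t)) (Icc 0 s') t)
    (hmem : ∀ t ∈ Icc 0 s', β t ∈ galerkinSubspace S) :
    ∀ t ∈ Icc 0 s', ∑ k, ‖β t k‖ ^ 2 ≤ ∑ k, ‖β 0 k‖ ^ 2 := by
  intro t ht
  set ψ : ℝ → ℝ := fun τ => ∑ k, ‖β τ k‖ ^ 2 with hψ
  set ψ' : ℝ → ℝ := fun τ => 2 * -(∑ k : ↥S, fracSymbol α (k : d → ℤ) * ‖β τ k‖ ^ 2) with hψ'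
  have hderiv : ∀ τ ∈ Icc 0 s', HasDerivWithinAt ψ (ψ' τ) (Icc 0 s') τ := fun τ hτ =>
    hasDerivWithinAt_fracEnergy α hS (hβ τ hτ) (hmem τ hτ)
  have hcont : ContinuousOn ψ (Icc 0 s') := fun τ hτ => (hderiv τ hτ).continuousWithinAt
  have hbound : ∀ τ ∈ Ico 0 s', ψ' τ ≤ 0 * ψ τ + 0 := by
    intro τ _
    have h0 : 0 ≤ ∑ k : ↥S, fracSymbol α (k : d → ℤ) * ‖β τ k‖ ^ 2 :=
      Finset.sum_nonneg fun k _ => mul_nonneg (fracSymbol_nonneg α _) (sq_nonneg _)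
    simp only [hψ', zero_mul, add_zero]
    linarith
  have hgron := le_gronwallBound_of_liminf_deriv_right_le (f := ψ) (f' := ψ') (δ := ψ 0) (K := 0)
    (ε := 0) (a := 0) (b := s') hcont (fun τ hτ r hr => ?_) le_rfl hbound t ht
  · simp only [gronwallBound_K0, zero_mul, add_zero, sub_zero] at hgron
    exact hgron
  · have hmem_nhds : Icc 0 s' ∈ 𝓝[Ici τ] τ :=
      mem_nhdsWithin.2 ⟨Iio s', isOpen_Iio, hτ.2, fun z hz => ⟨hτ.1.trans hz.2, hz.1.le⟩⟩
    exact ((hderiv τ (Ico_subset_Icc_self hτ)).mono_of_mem_nhdsWithin hmem_nhds)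
      |>.liminf_right_slope_le hr

end Energy

/-! ## Global solutions of the fractional Galerkin ODE -/

section Global

variable [DecidableEq d] {S : Finset (d → ℤ)}

/-- **Global existence for the fractional Galerkin system** (Colombo–De Lellis–De Rosa 2018, §9:
local well-posedness of the ODE system for `ŵ_k(t)` and "by a standard continuation argument …
a global solution on `ℝ⁺`"). Let `S` be a finite symmetric frequency set and `c₀` real and
divergence free. Then `β' = V_α(β)` has a solution `β : ℝ → (S → ℂ^d)` with `β 0 = c₀`, values in
the Galerkin phase space, continuous on `[0, ∞)`, solving the equation on every `[0, T]`
(one-sided derivatives at the endpoints). Proof: `ODE.exists_solution_of_apriori_bound` with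
`lipschitzOnWith_fracGalerkinRHS` and `fracEnergy_apriori_bound`. [cite: ColomboDelellisDerosa2018, §9 (proof of Thm. 1.1)] -/
theorem exists_fracGalerkin_solution (α : ℝ) (hS : ∀ k ∈ S, -k ∈ S)
    {c₀ : ↥S → EuclideanSpace ℂ d} (hc₀ : c₀ ∈ galerkinSubspace S) :
    ∃ β : ℝ → ↥S → EuclideanSpace ℂ d, β 0 = c₀ ∧ (∀ t, β t ∈ galerkinSubspace S) ∧
      Continuous β ∧
      ∀ T, ∀ t ∈ Icc 0 T, HasDerivWithinAt β
        (galerkinRHS S 0 (fun k : ↥S => -((((fracSymbol α (k : d → ℤ)) : ℝ) : ℂ) • β t k)) (β t)) (Icc 0 T) t := by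
  set Y := galerkinSubspace S with hY
  -- the fractional Galerkin field
  set W : (↥S → EuclideanSpace ℂ d) → ↥S → EuclideanSpace ℂ d :=
    fun c => galerkinRHS S 0 (fun k : ↥S => -((((fracSymbol α (k : d → ℤ)) : ℝ) : ℂ) • c k)) c with hW
  set V : ℝ → Y → Y := fun _ c => ⟨W c, fracGalerkinRHS_mem α hS c.2⟩ with hV
  have hVcoe : ∀ t (c : Y), ((V t c : Y) : ↥S → EuclideanSpace ℂ d) = W c := fun t c => rfl
  -- Lipschitz on balls
  have hlip : ∀ T ρ : ℝ, ∃ K : ℝ≥0, ∀ t ∈ Icc 0 T, LipschitzOnWith K (V t) (closedBall 0 ρ) := by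
    intro T ρ
    refine ⟨Real.toNNReal (((‖(0 : ℝ)‖ * (4 * Real.pi ^ 2 * ∑ k ∈ S, freqNormSq k) +
        2 * (2 * Real.pi * (S.card * ∑ m ∈ S, ∑ j, |(m j : ℝ)|) * ρ)) +
        ∑ k' ∈ S, fracSymbol α k')), fun t _ => ?_⟩
    refine LipschitzOnWith.of_dist_le_mul fun c hc c' hc' => ?_
    rw [mem_closedBall, dist_zero_right] at hc hc'
    rw [Subtype.dist_eq, dist_eq_norm, dist_eq_norm, hVcoe t c, hVcoe t c']
    have h := norm_fracGalerkinRHS_sub_le (S := S) α (ρ := ρ) (c := (c : ↥S → EuclideanSpace ℂ d))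
      (c' := (c' : ↥S → EuclideanSpace ℂ d)) (by simpa using hc) (by simpa using hc')
    exact h.trans (mul_le_mul_of_nonneg_right (Real.le_coe_toNNReal _) (norm_nonneg _))
  -- continuity in time (the field is autonomous)
  have hcont : ∀ c : Y, ContinuousOn (V · c) (Ici 0) := fun c => continuousOn_const
  -- a priori bound: the energy is non-increasing
  have hapriori : ∀ T : ℝ, 0 ≤ T → ∃ R : ℝ, ‖(⟨c₀, hc₀⟩ : Y)‖ ≤ R ∧
      ∀ s ∈ Icc 0 T, ∀ γ : ℝ → Y, γ 0 = ⟨c₀, hc₀⟩ →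
        (∀ t ∈ Icc 0 s, HasDerivWithinAt γ (V t (γ t)) (Icc 0 s) t) →
        ∀ t ∈ Icc 0 s, ‖γ t‖ ≤ R := by
    intro T _
    refine ⟨Real.sqrt (∑ k, ‖c₀ k‖ ^ 2), ?_, ?_⟩
    · change ‖c₀‖ ≤ _
      exact norm_le_sqrt_sum_norm_sq c₀
    · intro s _ γ hγ0 hγ t ht
      set β : ℝ → ↥S → EuclideanSpace ℂ d := fun τ => (γ τ : ↥S → EuclideanSpace ℂ d) with hβ
      have hβ' : ∀ τ ∈ Icc 0 s, HasDerivWithinAt β (W (β τ)) (Icc 0 s) τ := by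
        intro τ hτ
        exact Y.subtypeL.hasFDerivAt.comp_hasDerivWithinAt τ (hγ τ hτ)
      have hmem : ∀ τ ∈ Icc 0 s, β τ ∈ galerkinSubspace S := fun τ _ => (γ τ).2
      have hb := fracEnergy_apriori_bound α hS hβ' hmem t ht
      have hβ0 : β 0 = c₀ := by simp [hβ, hγ0]
      rw [hβ0] at hb
      change ‖β t‖ ≤ _
      exact (norm_le_sqrt_sum_norm_sq (β t)).trans (Real.sqrt_le_sqrt hb)
  obtain ⟨γ, hγ0, hγ⟩ := ODE.exists_solution_of_apriori_bound hlip hcont hapriori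
  -- continuity of `γ` on `[0, ∞)`
  have hγc : ContinuousOn (fun t => (γ t : ↥S → EuclideanSpace ℂ d)) (Ici 0) := by
    intro t ht
    have hc := IsIntegralCurveOn.continuousOn (hγ (t + 1)) t ⟨ht, by linarith⟩
    have hmem : Icc 0 (t + 1) ∈ 𝓝[Ici 0] t :=
      Filter.mem_of_superset (inter_mem_nhdsWithin (Ici (0 : ℝ)) (Iio_mem_nhds (by linarith)))
        fun s hs => ⟨hs.1, hs.2.le⟩
    exact (continuous_subtype_val.continuousAt.comp_continuousWithinAt hc).mono_of_mem_nhdsWithin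
      hmem
  -- the solution, frozen at its initial value for negative times (a global continuous curve)
  refine ⟨fun t => (γ (max t 0) : ↥S → EuclideanSpace ℂ d), by simp [hγ0], fun t => (γ _).2, ?_, ?_⟩
  · have h1 : Continuous fun t : ℝ => (⟨max t 0, le_max_right t 0⟩ : Ici (0 : ℝ)) :=
      (continuous_id.max continuous_const).subtype_mk _
    exact (continuousOn_iff_continuous_restrict.1 hγc).comp h1
  · intro T t ht
    have h := Y.subtypeL.hasFDerivAt.comp_hasDerivWithinAt t (hγ T t ht)
    have ht0 : max t 0 = t := max_eq_left ht.1
    refine (h.congr (fun τ hτ => ?_) ?_).congr_deriv ?_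
    · simp [max_eq_left hτ.1]
    · simp [ht0]
    · simp only [ht0]
      rfl

end Global

/-! ## The dictionary: from coefficient solutions to the clauses of the fractional scheme -/

section Dictionary

variable [DecidableEq d] {S : Finset (d → ℤ)}

omit [Fintype d] [DecidableEq d] in
/-- Negation of the coefficients negates the real trigonometric polynomial. [folklore] -/
theorem realTrigPoly_neg [Fintype d] (S : Finset (d → ℤ)) (c : (d → ℤ) → EuclideanSpace ℂ d) :
    realTrigPoly S (-c) = -realTrigPoly S c := by
  have h := realTrigPoly_sub S 0 c
  rwa [zero_sub, realTrigPoly_zero, zero_sub] at h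

omit [DecidableEq d] in
/-- **The force field of the spectral force is `-(-Δ)^α u`**: for a real coefficient vector `c`
and `u = realTrigPoly S c̄`, `realTrigPoly S (fracForce α c)‾ = -(-Δ)^α u`
(`Torus.fracLaplacian_realTrigPoly`). [folklore] -/
theorem realTrigPoly_coeffExt_fracForce (α : ℝ) (hS : ∀ k ∈ S, -k ∈ S)
    {c : ↥S → EuclideanSpace ℂ d} (hc : IsRealCoeff c) (x : UnitAddTorus d) :
    realTrigPoly S (coeffExt S
        (fun k : ↥S => -((((fracSymbol α (k : d → ℤ)) : ℝ) : ℂ) • c k))) x =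
      -fracLaplacian α (realTrigPoly S (coeffExt S c)) x := by
  rw [fracLaplacian_realTrigPoly hS (hc.isConjSymm_coeffExt hS) α x]
  have h : coeffExt S (fun k : ↥S => -((((fracSymbol α (k : d → ℤ)) : ℝ) : ℂ) • c k)) =
      -fun k => (((fracSymbol α k : ℝ)) : ℂ) • coeffExt S c k := by
    funext k
    rw [Pi.neg_apply]
    by_cases hk : k ∈ S
    · rw [coeffExt_of_mem _ hk, coeffExt_of_mem _ hk]
    · rw [coeffExt_of_not_mem _ hk, coeffExt_of_not_mem _ hk, smul_zero, neg_zero]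
  rw [h, realTrigPoly_neg, Pi.neg_apply]

omit [DecidableEq d] in
/-- Along a globally continuous coefficient curve the spectral force is a continuous real force
in the sense of the classical Galerkin ODE of the tree. [folklore] -/
theorem continuous_fracForce_comp (α : ℝ) {β : ℝ → ↥S → EuclideanSpace ℂ d} (hβ : Continuous β) :
    Continuous fun t => (fun k : ↥S => -((((fracSymbol α (k : d → ℤ)) : ℝ) : ℂ) • β t k)) :=
  (continuous_fracForce α).comp hβ

omit [DecidableEq d] in
/-- The fractional dissipation along a continuous real coefficient curve is continuous in time
(a finite sum `∑_k σ_α(k) ‖β t k‖²`; `α ≠ 0`). [folklore] -/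
theorem continuous_toReal_eFracDissipation_coeffExt {α : ℝ} (hα : α ≠ 0) (hS : ∀ k ∈ S, -k ∈ S)
    {β : ℝ → ↥S → EuclideanSpace ℂ d} (hβ : Continuous β) (hmem : ∀ t, β t ∈ galerkinSubspace S) :
    Continuous fun t => (eFracDissipation α (realTrigPoly S (coeffExt S (β t)))).toReal := by
  have h : (fun t => (eFracDissipation α (realTrigPoly S (coeffExt S (β t)))).toReal) =
      fun t => ∑ k : ↥S, fracSymbol α (k : d → ℤ) * ‖β t k‖ ^ 2 :=
    funext fun t => toReal_eFracDissipation_coeffExt hα hS (hmem t).1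
  rw [h]
  exact continuous_finsetSum _ fun k _ =>
    continuous_const.mul (((continuous_apply k).comp hβ).norm.pow 2)

/-- **The tested fractional Galerkin equations, integrated in time** (CDLDR 2018, §9, (NS_reg)
paired with a Galerkin mode). Let `β` be a continuous coefficient curve in the Galerkin phase
space solving the fractional Galerkin ODE on every `[0, T]`, and put `u(t) = realTrigPoly S (β t)‾`.
Then for every smooth divergence-free `a` band-limited to `S`, `0 ≤ s ≤ t` and `α ≥ 0`,
`∫⟪u t, a⟫ - ∫⟪u s, a⟫ = ∫ₛᵗ ∫ (⟪u, (u·∇)a⟫ - ⟪u, (-Δ)^α a⟫)` — the tree's classical tested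
identity `NS.galerkin_test_identity` at viscosity `0` with the spectral force, followed by
`⟪-(-Δ)^α u, a⟫ = -⟪u, (-Δ)^α a⟫` (`Torus.integral_inner_fracLaplacian_comm`).
[cite: ColomboDelellisDerosa2018, §9 (NS_reg)] -/
theorem fracGalerkin_test_identity {α : ℝ} (hα : 0 ≤ α) (hS : ∀ k ∈ S, -k ∈ S)
    {β : ℝ → ↥S → EuclideanSpace ℂ d} (hβc : Continuous β) (hmem : ∀ t, β t ∈ galerkinSubspace S)
    (hβ : ∀ T, ∀ t ∈ Icc 0 T, HasDerivWithinAt β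
      (galerkinRHS S 0 (fun k : ↥S => -((((fracSymbol α (k : d → ℤ)) : ℝ) : ℂ) • β t k)) (β t)) (Icc 0 T) t)
    {a : UnitAddTorus d → EuclideanSpace ℝ d} (ha : IsSmooth a) (hdiv : FunctionSpaces.Torus.IsDivFree a)
    (hband : ∀ k ∉ S, mFourierCoeff (FunctionSpaces.EuclideanSpace.complexify ∘ a) k = 0)
    {s t : ℝ} (hs : 0 ≤ s) (hst : s ≤ t) :
    (∫ x, ⟪realTrigPoly S (coeffExt S (β t)) x, a x⟫_ℝ) -
        ∫ x, ⟪realTrigPoly S (coeffExt S (β s)) x, a x⟫_ℝ =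
      ∫ τ in s..t, ∫ x, (⟪realTrigPoly S (coeffExt S (β τ)) x,
          FunctionSpaces.Torus.convect (realTrigPoly S (coeffExt S (β τ))) a x⟫_ℝ -
        ⟪realTrigPoly S (coeffExt S (β τ)) x, fracLaplacian α a x⟫_ℝ) := by
  have hg := continuous_fracForce_comp (S := S) α hβc
  have hgr : ∀ τ, IsRealCoeff (fun k : ↥S => -((((fracSymbol α (k : d → ℤ)) : ℝ) : ℂ) • β τ k)) :=
    fun τ => (hmem τ).1.fracForce α
  have h := galerkin_test_identity (S := S) 0 hS hg hgr hmem (fun T τ hτ => hβ T τ hτ) ha hdiv hband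
    hs hst
  rw [h]
  refine intervalIntegral.integral_congr fun τ _ => ?_
  have hu : IsSmooth (realTrigPoly S (coeffExt S (β τ))) := isSmooth_realTrigPoly S _
  -- pointwise: the force term is `-⟪(-Δ)^α u, a⟫`
  have hpt : ∀ x, ⟪realTrigPoly S (coeffExt S (β τ)) x,
      FunctionSpaces.Torus.convect (realTrigPoly S (coeffExt S (β τ))) a x⟫_ℝ +
      0 * ⟪realTrigPoly S (coeffExt S (β τ)) x, laplacian a x⟫_ℝ +
      ⟪realTrigPoly S (coeffExt S
        (fun k : ↥S => -((((fracSymbol α (k : d → ℤ)) : ℝ) : ℂ) • β τ k))) x, a x⟫_ℝ =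
      ⟪realTrigPoly S (coeffExt S (β τ)) x,
        FunctionSpaces.Torus.convect (realTrigPoly S (coeffExt S (β τ))) a x⟫_ℝ -
      ⟪fracLaplacian α (realTrigPoly S (coeffExt S (β τ))) x, a x⟫_ℝ := by
    intro x
    rw [realTrigPoly_coeffExt_fracForce α hS (hmem τ).1 x, inner_neg_left, zero_mul, add_zero,
      sub_eq_add_neg]
  simp_rw [hpt]
  have i1 : Integrable (fun x => ⟪realTrigPoly S (coeffExt S (β τ)) x,
      FunctionSpaces.Torus.convect (realTrigPoly S (coeffExt S (β τ))) a x⟫_ℝ) volume :=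
    (hu.inner (hu.convect ha)).integrable
  have i2 : Integrable (fun x => ⟪fracLaplacian α (realTrigPoly S (coeffExt S (β τ))) x, a x⟫_ℝ)
      volume :=
    ((continuous_fracLaplacian hα hu).inner ha.continuous).integrable_unitAddTorus
  have i3 : Integrable (fun x => ⟪realTrigPoly S (coeffExt S (β τ)) x, fracLaplacian α a x⟫_ℝ)
      volume :=
    (hu.continuous.inner (continuous_fracLaplacian hα ha)).integrable_unitAddTorus
  rw [integral_sub i1 i2, integral_sub i1 i3, integral_inner_fracLaplacian_comm hα hu ha]

/-- **The energy identity of fractional Galerkin solutions** (CDLDR 2018, §9: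
`½∫|w_K|²(t) + ∫ₛᵗ∫|(-Δ)^{α/2}w_K|² = ½∫|w_K|²(s)`). With `β`, `u` as in
`fracGalerkin_test_identity`, `0 ≤ s ≤ t` and `α ≠ 0`,
`½‖u t‖² + ∫ₛᵗ D_α(u) = ½‖u s‖²`, the dissipation written as `(∫⁻_{(s,t)} eFracDissipation α (u τ)).toReal`
(the tree's classical energy identity `NS.galerkin_energy_identity` at viscosity `0` with the
spectral force, whose work is `-D_α(u)`, `integral_inner_realTrigPoly_fracForce`).
[cite: ColomboDelellisDerosa2018, §9 (energy identity of (NS_reg))] -/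
theorem fracGalerkin_energy_identity {α : ℝ} (hα : α ≠ 0) (hS : ∀ k ∈ S, -k ∈ S)
    {β : ℝ → ↥S → EuclideanSpace ℂ d} (hβc : Continuous β) (hmem : ∀ t, β t ∈ galerkinSubspace S)
    (hβ : ∀ T, ∀ t ∈ Icc 0 T, HasDerivWithinAt β
      (galerkinRHS S 0 (fun k : ↥S => -((((fracSymbol α (k : d → ℤ)) : ℝ) : ℂ) • β t k)) (β t)) (Icc 0 T) t)
    {s t : ℝ} (hs : 0 ≤ s) (hst : s ≤ t) :
    kineticEnergy (realTrigPoly S (coeffExt S (β t))) +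
        (∫⁻ τ in Ioo s t, eFracDissipation α (realTrigPoly S (coeffExt S (β τ)))).toReal =
      kineticEnergy (realTrigPoly S (coeffExt S (β s))) := by
  have hg := continuous_fracForce_comp (S := S) α hβc
  have hgr : ∀ τ, IsRealCoeff (fun k : ↥S => -((((fracSymbol α (k : d → ℤ)) : ℝ) : ℂ) • β τ k)) :=
    fun τ => (hmem τ).1.fracForce α
  have h := galerkin_energy_identity (S := S) 0 hS hg hgr hmem (fun T τ hτ => hβ T τ hτ) hs hst
  rw [zero_mul, add_zero] at h
  -- the work of the spectral force is minus the dissipation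
  obtain ⟨E, hE⟩ : ∃ E : ℝ → ℝ,
      E = fun τ => (eFracDissipation α (realTrigPoly S (coeffExt S (β τ)))).toReal := ⟨_, rfl⟩
  have hE_eq : ∀ τ, E τ = ∑ k : ↥S, fracSymbol α (k : d → ℤ) * ‖β τ k‖ ^ 2 := by
    intro τ; subst hE; exact toReal_eFracDissipation_coeffExt hα hS (hmem τ).1
  have hwork : ∀ τ, ∫ x, ⟪realTrigPoly S (coeffExt S
      (fun k : ↥S => -((((fracSymbol α (k : d → ℤ)) : ℝ) : ℂ) • β τ k))) x,
      realTrigPoly S (coeffExt S (β τ)) x⟫_ℝ = -E τ := by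
    intro τ
    rw [integral_inner_realTrigPoly_fracForce α hS (hmem τ).1, hE_eq]
  simp_rw [hwork] at h
  rw [intervalIntegral.integral_neg] at h
  -- continuity and nonnegativity of the dissipation
  have hEc : Continuous E := by
    subst hE; exact continuous_toReal_eFracDissipation_coeffExt hα hS hβc hmem
  have hnn' : ∀ τ, 0 ≤ E τ := fun τ => by
    rw [hE_eq]
    exact Finset.sum_nonneg fun k _ => mul_nonneg (fracSymbol_nonneg α _) (sq_nonneg _)
  -- the dissipation as a `lintegral`
  have hlint : (∫⁻ τ in Ioo s t, eFracDissipation α (realTrigPoly S (coeffExt S (β τ)))).toReal =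
      ∫ τ in s..t, E τ := by
    have heq : ∀ τ, eFracDissipation α (realTrigPoly S (coeffExt S (β τ))) = ENNReal.ofReal (E τ) := by
      intro τ
      rw [hE_eq, eFracDissipation_coeffExt hα hS (hmem τ).1]
    simp_rw [heq]
    have hint : IntegrableOn E (Ioo s t) volume :=
      (hEc.integrableOn_Icc (a := s) (b := t)).mono_set Ioo_subset_Icc_self
    have hnn : 0 ≤ᵐ[volume.restrict (Ioo s t)] E := ae_of_all _ hnn'
    rw [← ofReal_integral_eq_lintegral_ofReal hint hnn, ENNReal.toReal_ofReal
      (integral_nonneg hnn'), intervalIntegral.integral_of_le hst, integral_Ioc_eq_integral_Ioo]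
  rw [hlint]
  linarith

end Dictionary

end FracODE

end Literature.Analysis.FluidPDE
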